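import Literature.NumberTheory.Automorphic.LocalOrbitalIntegral
import Literature.MeasureTheory.Group.InvariantQuotientTransport
import HarnessLib

/-!
# Orbital integrals at CENTRAL elements, and the Bochner transport of orbital integrands to a non-centraliser
# target subgroup
(Rogawski (1990), §4.13, proof of Lemma 4.13.1 p. 70: at the `(G, H)`-regular singular element `H_γ = M`, and on the
endoscopic side `γ^H` is central; Deitmar–Echterhoff (2014), Thm. 1.5.3: the canonical quotient measure)

Topic `NumberTheory/Automorphic`; namespace `Literature.NumberTheory.Automorphic`. THEOREMS ONLY (no definition, no instance,
no named fact, no `sorry`); generic in the group. Cell `pub/hodgecm-mathlib`, programme P3a, road (κ-loc-split) under row #88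
(LEAD F0P3a-plan T6-92∕T6-97 «D-S1e», generic half): the two group-agnostic facts the split singular pair
(★ `UnitaryGroupSplitPlaceSingularPair`) combines with the dictionary ★ `UnitaryGroupSplitPlaceOrbitalIntegral` («D-S1d»).

§1 CENTRAL ELEMENTS (`g γ g⁻¹ = γ` for all `g`, so `C(γ) = G` and `G ⧸ C(γ)` is ONE point):
* `orbitalIntegral_eq_smul_of_forall_conj_eq` — `Φ(γ, f; m) = m(G ⧸ C(γ)) • f γ` for every measure `m` (Bochner twin of ★
  `lintegral_descConj_eq_mul_of_forall_conj_eq`, «D-S1c⁰»);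
* `quotientMeasure_centralizer_univ_mul_eq` — for the canonical `ν/ρ`: `(ν/ρ)(pt) · ρ(C(γ) ∩ K) = ν(K)` (Weil's formula ★
  `lintegral_fiberLIntegral_quotientMeasure` at `1_K`); `quotientMeasure_centralizer_univ_eq_one` (mass `1` when
  `ν(K) = 1 = ρ(C(γ) ∩ K)`); **`orbitalIntegral_quotientMeasure_eq_self_of_forall_conj_eq`** — then `Φ(γ, f; ν/ρ) = f γ`: the
  endoscopic-side integral `Φ^{H_v}(γ₀^H, 1_{K_H}) = 1_{K_H}(γ₀^H)` at the CENTRAL `γ₀^H = (t₁ 1_I, t₂ 1_J)` of the split singular pair,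
  in ANY model of `H_v` (no split isomorphism of the endoscopic group is needed).
§2 TRANSPORT TO A NON-CENTRALISER TARGET: **`integral_descConj_quotientMeasure_eq_of_mulEquiv`** — for a bicontinuous `e : G ≃* G'`,
closed `H ≤ G` centralising `γ`, `H' = e(H)` centralising `γ' = e γ`, `ρ' = (e|_H)_* ρ`, `ν' = e_* ν`:
`∫_{G'/H'} F(y γ' y⁻¹) d(ν'/ρ') = ∫_{G/H} F(e(x γ x⁻¹)) d(ν/ρ)` (the Bochner twin of ★ `lintegral_descConj_quotientMeasure_eq_of_mulEquiv`;
used with `H' = M_{c′}` FIXED, so that one GL-side constant serves every singular class); `map_subgroupCongrHomeomorph_apply_setOf_mem`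
(`((e|_H)_* ρ)(H' ∩ K') = ρ(H ∩ K)` for level-matched `K ↔ K'`).

## References
* J. D. Rogawski, *Automorphic Representations of Unitary Groups in Three Variables* (1990), §4.13, proof of Lemma 4.13.1 p. 70;
  §4.3 p. 44 [Rogawski1990].
* A. Deitmar, S. Echterhoff, *Principles of Harmonic Analysis*, 2nd ed. (2014), Thm. 1.5.3 [DeitmarEchterhoff2014].
-/

set_option autoImplicit false

noncomputable section

open MeasureTheory Measure Set Filter Topology Literature.MeasureTheory.Group
open scoped ENNReal NNReal

namespace Literature.NumberTheory.Automorphic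

/-! ## §1 Central elements: `G ⧸ C(γ)` is a point -/

section Central

variable {G : Type*} [Group G] {γ : G} (hγ : ∀ g : G, g * γ * g⁻¹ = γ)

include hγ in
/-- A central element is centralised by everything. [folklore] -/
private theorem mem_centralizer_of_forall_conj_eq (g : G) : g ∈ Subgroup.centralizer ({γ} : Set G) := by
  rw [Subgroup.mem_centralizer_singleton_iff]
  calc g * γ = g * γ * g⁻¹ * g := by group
    _ = γ * g := by rw [hγ g]

include hγ in
/-- For a central `γ` the orbit space `G ⧸ C(γ)` is the single point `1 · C(γ)`. [folklore] -/
private theorem eq_mk_one_of_forall_conj_eq (x : G ⧸ Subgroup.centralizer ({γ} : Set G)) :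
    x = QuotientGroup.mk 1 := by
  induction x using QuotientGroup.induction_on with
  | H g => exact QuotientGroup.eq.2 (mem_centralizer_of_forall_conj_eq hγ _)

include hγ in
/-- **The orbital integral at a central element**: `Φ(γ, f; m) = m(G ⧸ C(γ)) • f γ` for EVERY measure `m` on the
one-point orbit space (the orbital integrand is the constant `f γ`; Bochner twin of ★ `lintegral_descConj_eq_mul_of_forall_conj_eq`).
[cite: Rogawski1990, §4.13, proof of Lemma 4.13.1, p. 70] -/
theorem orbitalIntegral_eq_smul_of_forall_conj_eq [MeasurableSpace (G ⧸ Subgroup.centralizer ({γ} : Set G))]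
    {B : Type*} [NormedAddCommGroup B] [NormedSpace ℝ B] [CompleteSpace B] (f : G → B) (m : Measure (G ⧸ Subgroup.centralizer ({γ} : Set G))) :
    orbitalIntegral γ f m = (m univ).toReal • f γ := by
  rw [orbitalIntegral_eq_integral_descConj]
  have h : ∀ y, descConj γ (Subgroup.centralizer ({γ} : Set G)) (fun _ hg => Subgroup.mem_centralizer_singleton_iff.1 hg) f y =
      f γ := fun y => by
    induction y using QuotientGroup.induction_on with
    | H g => rw [descConj_mk, hγ]
  simp_rw [h]
  rw [integral_const]
  rfl

variable [TopologicalSpace G] [IsTopologicalGroup G] [LocallyCompactSpace G] [SecondCountableTopology G] [T2Space G]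
  [MeasurableSpace G] [BorelSpace G]
  (hC : IsClosed ((Subgroup.centralizer ({γ} : Set G) : Subgroup G) : Set G))
  [MeasurableSpace (G ⧸ Subgroup.centralizer ({γ} : Set G))] [BorelSpace (G ⧸ Subgroup.centralizer ({γ} : Set G))]
  (ρ : Measure (Subgroup.centralizer ({γ} : Set G))) [ρ.IsMulLeftInvariant] [IsFiniteMeasureOnCompacts ρ]
  [ρ.IsOpenPosMeasure] [ρ.IsInvInvariant]
  (ν : Measure G) [IsHaarMeasure ν] [ν.IsMulRightInvariant]

include hγ in
/-- **The mass of the one-point orbit space of a central element** for the canonical quotient measure `ν/ρ`: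
`(ν/ρ)(G ⧸ C(γ)) · ρ(C(γ) ∩ K) = ν(K)` for every Borel `K ⊆ G` (Weil's formula ★ `lintegral_fiberLIntegral_quotientMeasure`
at `1_K`: the fibre integral is the constant `ρ(C(γ) ∩ K)`). [cite: DeitmarEchterhoff2014, Thm. 1.5.3] -/
theorem quotientMeasure_centralizer_univ_mul_eq {K : Set G} (hK : MeasurableSet K) :
    quotientMeasure (Subgroup.centralizer ({γ} : Set G)) ρ hC ν univ *
        ρ {h : Subgroup.centralizer ({γ} : Set G) | (h : G) ∈ K} = ν K := by
  haveI : IsClosed ((Subgroup.centralizer ({γ} : Set G) : Subgroup G) : Set G) := hC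
  have hW := lintegral_fiberLIntegral_quotientMeasure (Subgroup.centralizer ({γ} : Set G)) ρ ν
    (f := K.indicator 1) ((measurable_const : Measurable (1 : G → ℝ≥0∞)).indicator hK)
  rw [lintegral_indicator_one hK] at hW
  have hfib : ∀ x, fiberLIntegral (Subgroup.centralizer ({γ} : Set G)) ρ (K.indicator 1) x =
      ρ {h : Subgroup.centralizer ({γ} : Set G) | (h : G) ∈ K} := fun x => by
    rw [eq_mk_one_of_forall_conj_eq hγ x, fiberLIntegral_mk]
    simp only [one_mul]
    have h1 : (fun h : Subgroup.centralizer ({γ} : Set G) => K.indicator (1 : G → ℝ≥0∞) (h : G)) =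
        (Subtype.val ⁻¹' K).indicator 1 := by
      funext h
      rfl
    rw [h1, lintegral_indicator_one (hK.preimage measurable_subtype_coe)]
    rfl
  simp_rw [hfib, lintegral_const] at hW
  rwa [mul_comm] at hW

include hγ in
/-- Hence `(ν/ρ)(G ⧸ C(γ)) = 1` when `ν(K) = 1 = ρ(C(γ) ∩ K)` for one Borel `K` (e.g. `K = K_H`, the integral level).
[cite: DeitmarEchterhoff2014, Thm. 1.5.3] -/
theorem quotientMeasure_centralizer_univ_eq_one {K : Set G} (hK : MeasurableSet K) (hν : ν K = 1)
    (hρ : ρ {h : Subgroup.centralizer ({γ} : Set G) | (h : G) ∈ K} = 1) :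
    quotientMeasure (Subgroup.centralizer ({γ} : Set G)) ρ hC ν univ = 1 := by
  have h := quotientMeasure_centralizer_univ_mul_eq hγ hC ρ ν hK
  rwa [hρ, mul_one, hν] at h

include hγ in
/-- **(e2) The orbital integral at a central element against the normalised canonical measure is the point value**:
`Φ(γ, f; ν/ρ) = f γ` when `ν(K) = 1 = ρ(C(γ) ∩ K)`; at `f = 1_K`: `Φ(γ, 1_K) = 1_K(γ)` — the `H`-side integral at the
central `γ₀^H = (t₁ 1_I, t₂ 1_J)` of the split singular pair, in ANY model of `H_v`. [cite: Rogawski1990, §4.13, proof of Lemma 4.13.1, p. 70] -/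
theorem orbitalIntegral_quotientMeasure_eq_self_of_forall_conj_eq {K : Set G} (hK : MeasurableSet K) (hν : ν K = 1)
    (hρ : ρ {h : Subgroup.centralizer ({γ} : Set G) | (h : G) ∈ K} = 1)
    {B : Type*} [NormedAddCommGroup B] [NormedSpace ℝ B] [CompleteSpace B] (f : G → B) :
    orbitalIntegral γ f (quotientMeasure (Subgroup.centralizer ({γ} : Set G)) ρ hC ν) = f γ := by
  rw [orbitalIntegral_eq_smul_of_forall_conj_eq hγ, quotientMeasure_centralizer_univ_eq_one hγ hC ρ ν hK hν hρ,
    ENNReal.toReal_one, one_smul]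

end Central

/-! ## §2 Transport to a non-centraliser target subgroup (Bochner) -/

section Transport

variable {G G' : Type*} [Group G] [Group G'] [TopologicalSpace G] [TopologicalSpace G']
  [IsTopologicalGroup G] [IsTopologicalGroup G'] [LocallyCompactSpace G] [LocallyCompactSpace G']
  [SecondCountableTopology G] [SecondCountableTopology G'] [T2Space G] [T2Space G']
  [MeasurableSpace G] [BorelSpace G] [MeasurableSpace G'] [BorelSpace G']
  (e : G ≃* G') (he : Continuous e) (hes : Continuous e.symm)
  (H : Subgroup G) [hH : IsClosed (H : Set G)] (H' : Subgroup G') [hH' : IsClosed (H' : Set G')]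
  (hHH' : ∀ g, e g ∈ H' ↔ g ∈ H)
  [MeasurableSpace (G ⧸ H)] [BorelSpace (G ⧸ H)] [MeasurableSpace (G' ⧸ H')] [BorelSpace (G' ⧸ H')]
  (ρ : Measure H) [ρ.IsMulLeftInvariant] [IsFiniteMeasureOnCompacts ρ] [ρ.IsOpenPosMeasure]
  [ρ.IsInvInvariant] [SFinite ρ]
  (ρ' : Measure H') [ρ'.IsMulLeftInvariant] [IsFiniteMeasureOnCompacts ρ'] [ρ'.IsOpenPosMeasure]
  [ρ'.IsInvInvariant] [SFinite ρ']
  (ν : Measure G) [IsHaarMeasure ν] [ν.IsMulRightInvariant]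
  (ν' : Measure G') [IsHaarMeasure ν'] [ν'.IsMulRightInvariant]

/-- **Orbital integrands over ANY pair of matched closed subgroups correspond, with equality** (Bochner twin of ★
`lintegral_descConj_quotientMeasure_eq_of_mulEquiv`): for `H ≤ G` centralising `γ`, `H' = e(H)` centralising `γ' = e γ`,
`ρ' = (e|_H)_* ρ`, `ν' = e_* ν`: `∫_{G'/H'} F(y γ' y⁻¹) d(ν'/ρ') = ∫_{G/H} F(e(x γ x⁻¹)) d(ν/ρ)`.
[cite: DeitmarEchterhoff2014, Thm. 1.5.3] -/
theorem integral_descConj_quotientMeasure_eq_of_mulEquiv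
    (hρ' : ρ' = Measure.map (subgroupCongrHomeomorph e H H' hHH' he hes) ρ) (hν' : ν' = Measure.map e ν)
    {γ : G} {γ' : G'} (hγ : e γ = γ') (hHγ : ∀ g ∈ H, g * γ = γ * g) (hH'γ : ∀ g ∈ H', g * γ' = γ' * g)
    {B : Type*} [NormedAddCommGroup B] [NormedSpace ℝ B] (F : G' → B) :
    ∫ y, descConj γ' H' hH'γ F y ∂quotientMeasure H' ρ' hH' ν' =
      ∫ x, descConj γ H hHγ (F ∘ e) x ∂quotientMeasure H ρ hH ν := by
  subst hγ
  rw [← map_cosetCongr_quotientMeasure e he hes H H' hHH' ρ ρ' ν ν' hρ' hν', ← coe_cosetCongrHomeomorph e H H' hHH' he hes,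
    ← Homeomorph.toMeasurableEquiv_coe, integral_map_equiv]
  refine integral_congr_ae (Eventually.of_forall fun x => ?_)
  induction x using QuotientGroup.induction_on with
  | H g => simp only [Homeomorph.toMeasurableEquiv_coe, coe_cosetCongrHomeomorph, cosetCongr_mk, descConj_mk,
      Function.comp_apply, map_mul, map_inv]

omit [IsTopologicalGroup G] [IsTopologicalGroup G'] [LocallyCompactSpace G] [LocallyCompactSpace G']
  [SecondCountableTopology G] [SecondCountableTopology G'] [T2Space G] [T2Space G'] hH hH'
  [MeasurableSpace (G ⧸ H)] [BorelSpace (G ⧸ H)] [MeasurableSpace (G' ⧸ H')] [BorelSpace (G' ⧸ H')]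
  [ρ.IsMulLeftInvariant] [IsFiniteMeasureOnCompacts ρ] [ρ.IsOpenPosMeasure] [ρ.IsInvInvariant] [SFinite ρ] in
/-- **Level masses transport on the subgroups**: if `e g ∈ K' ↔ g ∈ K`, then `((e|_H)_* ρ)(H' ∩ K') = ρ(H ∩ K)` — a
normalisation «`vol(H ∩ K) = 1`» becomes «`vol(H' ∩ K') = 1`». [cite: Rogawski1990, §4.3 p. 44] -/
theorem map_subgroupCongrHomeomorph_apply_setOf_mem {K : Set G} {K' : Set G'} (hK : ∀ g, e g ∈ K' ↔ g ∈ K) :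
    (ρ.map (subgroupCongrHomeomorph e H H' hHH' he hes)) {h' : H' | (h' : G') ∈ K'} = ρ {h : H | (h : G) ∈ K} := by
  rw [← Homeomorph.toMeasurableEquiv_coe, MeasurableEquiv.map_apply]
  congr 1
  ext h
  simp only [mem_preimage, mem_setOf_eq, Homeomorph.toMeasurableEquiv_coe, coe_subgroupCongrHomeomorph_apply]
  exact hK h

end Transport

end Literature.NumberTheory.Automorphic

end
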